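import Mathlib
import Summits.ValiantsHypothesis.ValiantsHypothesis.Theorems.FeketeSOSCharPSparseSOSStubDictionaryAtInfinity

/-!
# Crux `FeketeSOS.CharPSparseSOS` (stmt-ValiantsHypothesis-14989), line `Sketch` — sub-goal `twoCuspUncertainty`

Transversality of the two cusp flags (an uncertainty principle): for a non-zero polynomial `P` of
degree `< p` over a field `K` of characteristic `p`, if `(X - 1)^{D₁} ∣ P` (depth `≥ D₁` at the
upper cusp) and `P_0 = 0` together with the vanishing of the top moments `Σ_{n<p} P_n n^{p-1-d}`,
`1 ≤ d < D₂` (depth `≥ D₂` at the lower cusp), then `D₁ + D₂ ≤ p - 1`.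

Proof.  Suppose `D₁ + D₂ ≥ p`.  Since `(X - 1)^{D₁} ∣ P ≠ 0`, `D₁ ≤ deg P ≤ p - 1`, so `D₂ ≥ 1`
and `P_0 = 0`.  By the dictionary at the upper cusp (`stub_dictionaryAtInfinity`) the power moments
`μ_a = Σ_{n<p} P_n n^a` vanish for `a < D₁`, and by the lower-cusp hypothesis at `d = p - 1 - a`
they vanish for `p - 1 - D₂ < a ≤ p - 2`; as `D₁ + D₂ ≥ p` this covers every `a ≤ p - 2`.
Dropping the `n = 0` term (`P_0 = 0`), `Σ_{n=1}^{p-1} P_n n^a = 0` for all `a < p - 1` is a square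
Vandermonde system on the pairwise distinct nodes `(n : K)`, `1 ≤ n ≤ p - 1`
(`CharP.natCast_injOn_Iio`), so every `P_n` vanishes
(`Matrix.eq_zero_of_forall_pow_sum_mul_pow_eq_zero`) and `P = 0` — a contradiction.
-/

-- `Summit.ValiantsHypothesis.ValiantsHypothesis.…` is the tree's mandated single-conjunct layout (Sub = Summit).
set_option linter.dupNamespace false

namespace Summit.ValiantsHypothesis.ValiantsHypothesis.Theorems.CharPSparseSOSTwoCusp

open Polynomial Finset

/-- **Two-cusp uncertainty principle** `δ_∞(P) + δ_0(P) ≤ p - 1`.  Over a field `K` of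
characteristic `p`, a non-zero `P : K[X]` with `natDegree P < p`, `(X - C 1) ^ D₁ ∣ P`,
`P.coeff 0 = 0` (when `1 ≤ D₂`) and vanishing top moments `Σ_{n<p} P.coeff n * n^{p-1-d} = 0` for
`1 ≤ d < D₂` satisfies `D₁ + D₂ ≤ p - 1`: otherwise all power moments of order `≤ p - 2` of the
coefficient function vanish, and the Vandermonde system on the nodes `1, …, p - 1 ∈ K` forces
`P = 0`. -/
theorem twoCuspUncertainty :
    ∀ (K : Type) [Field K] (p : ℕ) [Fact p.Prime] [CharP K p] (P : K[X]) (D₁ D₂ : ℕ), P ≠ 0 → P.natDegree < p →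
      (X - C (1 : K)) ^ D₁ ∣ P → (1 ≤ D₂ → P.coeff 0 = 0) →
      (∀ d : ℕ, 1 ≤ d → d < D₂ → ∑ n ∈ Finset.range p, P.coeff n * (n : K) ^ (p - 1 - d) = 0) →
      D₁ + D₂ ≤ p - 1 := by
  intro K _ p _ _ P D₁ D₂ hP hdeg hdvd h0 hmom
  classical
  by_contra hlt
  rw [not_le] at hlt
  have hp : p.Prime := Fact.out
  -- (1) `D₁ ≤ deg P < p`, hence `1 ≤ D₂` and `P_0 = 0`.
  have hD1 : D₁ < p := by
    have h := natDegree_le_of_dvd hdvd hP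
    rw [natDegree_pow, natDegree_X_sub_C, mul_one] at h
    exact lt_of_le_of_lt h hdeg
  have hP0 : P.coeff 0 = 0 := h0 (by omega)
  -- (2)+(3) every power moment of order `< p - 1` vanishes.
  have hμ : ∀ a : ℕ, a < p - 1 → ∑ n ∈ range p, P.coeff n * (n : K) ^ a = 0 := by
    intro a ha
    by_cases haD : a < D₁
    · exact (stub_dictionaryAtInfinity K p P D₁ hdeg hD1.le).mp hdvd a haD
    · have h := hmom (p - 1 - a) (by omega) (by omega)
      rwa [show p - 1 - (p - 1 - a) = a by omega] at h
  -- (4) drop the `n = 0` term and index the nodes `1, …, p - 1` by `Fin (p - 1)`.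
  have hμ' : ∀ a : ℕ, a < p - 1 →
      ∑ j : Fin (p - 1), P.coeff ((j : ℕ) + 1) * (((j : ℕ) + 1 : ℕ) : K) ^ a = 0 := by
    intro a ha
    have h := hμ a ha
    rw [← Nat.sub_add_cancel hp.one_lt.le, sum_range_succ', hP0, zero_mul, add_zero,
      sum_range] at h
    exact h
  -- The Vandermonde system on the pairwise distinct nodes `(n : K)`, `1 ≤ n ≤ p - 1`.
  let f : Fin (p - 1) → K := fun j => (((j : ℕ) + 1 : ℕ) : K)
  let v : Fin (p - 1) → K := fun j => P.coeff ((j : ℕ) + 1)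
  have hf : Function.Injective f := by
    intro i j h
    have hi : (i : ℕ) + 1 ∈ Set.Iio p := Set.mem_Iio.mpr (by omega)
    have hj : (j : ℕ) + 1 ∈ Set.Iio p := Set.mem_Iio.mpr (by omega)
    have hij := CharP.natCast_injOn_Iio K p hi hj h
    exact Fin.ext (by omega)
  have hv : v = 0 :=
    Matrix.eq_zero_of_forall_pow_sum_mul_pow_eq_zero hf fun i => hμ' i i.isLt
  -- Hence every coefficient of `P` vanishes: `P = 0`, absurd.
  refine hP (Polynomial.ext fun n => ?_)
  rw [coeff_zero]
  rcases Nat.eq_zero_or_pos n with rfl | hn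
  · exact hP0
  · by_cases hnp : n < p
    · have h := congr_fun hv ⟨n - 1, by omega⟩
      simp only [v, Pi.zero_apply] at h
      rwa [show n - 1 + 1 = n by omega] at h
    · exact coeff_eq_zero_of_natDegree_lt (by omega)

end Summit.ValiantsHypothesis.ValiantsHypothesis.Theorems.CharPSparseSOSTwoCusp
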